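/-
Copyright (c) 2026 the pub-hodgecm-mathlib formalisation cell (harness21).  Prover seat hodgecm-mathlib-K2E5-p17 (g7), Track B «K2-LIT»,
#184♮ = hLiu418 = `stmt-HodgeConjecture-24832`; organ S2 «ARCH SPAN BY K-TYPE PATHS» (LEAD F0P6-plan (g14) RULING M-158f, DESIGN-S2 41bd43fff4457fcc §2 (T) ∕ §3 (vi) ∕ §4 row S2-T;
third reader K2Liu-ref1 (g5) TESTVECTORS-S2T 663341ae91317f68 §1; letters = ★ S2-K DEFS leaf `K2LiuU22CompactPictureDefs` §1 (K2Liu-p10 (g4), (D1) «S2-T is generic»)).  2026-09-04.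
-/
import Summits.HodgeConjecture.HodgeConjecture.Theorems.K2LiuU22CompactPictureDefs   -- ★ S2-K DEFS leaf (K2Liu-p10): `mOp`, `pOp`, `fkl`, `hk` (generic letters §1)
import Mathlib.Tactic.LinearCombination
import Mathlib.Tactic.FinCases
import Mathlib.Tactic.Ring
import HarnessLib

/-!
# Crux `HLiu418`, organ S2, file S2-T: THE K-TYPE TRANSITION IDENTITIES — Weil's `𝔭^±` operators `P_{ab}`, `M_{ab}` on the highest-weight vectors `u₀₀^k · D^l`
# of the compact-picture ring `ℂ[u_{ij}, D⁻¹]`, with the four affine transition scalars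

Cell `hodgecm-mathlib`, crux item hLiu418 = `stmt-HodgeConjecture-24832`, route of record `HCCMUnconditional`; squad K2 ∕ K2Liu, prover K2E5-p17 (g7).
THEOREMS ONLY (no `def`, no instance, no notation, no named-fact hypothesis, no `sorry`); lane `--supports stmt-HodgeConjecture-24832 --as helper` (count-neutral).

SETTING (★ `K2LiuU22CompactPictureDefs` §1, GENERIC — ref1 (D1)): any commutative `ℂ`-algebra `R` with a matrix of elements `u : Matrix (Fin 2) (Fin 2) R`, an inverse
`Dinv` of `det u` (`hD : u.det * Dinv = 1`), derivations `d i j : Derivation ℂ R R` with `d i j (u k l) = δ_{ik}δ_{jl}` (`hd`), and a family of powers `Dz : ℤ → R` of `det u`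
(`hDz0 : Dz 0 = 1`, `hDz : Dz (l+1) = Dz l * det u`; on the carrier `𝒜 = ℂ[u_{ij}, D⁻¹]` these are ★ `dz_zero`, `dz_add`∕`dz_one`).  Operators (★, FREE scalars `p q : ℂ`,
Lean indices `0, 1` = the memos' `1, 2`): `pOp d u Dinv p a b F = p·(u⁻¹)_{ba}·F − d_{ab} F` (𝔭⁺) and `mOp d u q a b F = q·u_{ba}·F + Σ_{ij} u_{ia} u_{bj} d_{ij} F` (𝔭⁻);
test family `fkl u Dz k l = u₀₀^k · Dz l` (highest weight `λ = (k+l, l)`) and harmonic companion `hk u k = u₀₀^k u₁₁ + k·u₀₀^{k−1} u₀₁ u₁₀`.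

THE MATHEMATICS ([LeeZhu1998, p. 5032 «transition coefficients»]; ref1 TESTVECTORS-S2T §1 (84 triples verified by `s2/s2t_identities.py`); DESIGN-S2 §2 (T)).  Purely by the
Leibniz rule — `d_{ij}(u₀₀^k D^l) = k u₀₀^{k−1} D^l δ_{i0}δ_{j0} + l u₀₀^k D^{l−1} adj(u)_{ji}` — the eight identities (§2) hold in EVERY such `(R, u, Dinv, d, Dz)`:
`M₀₀ F_{k,l} = (q+k+l) F_{k+1,l}`, `M₀₁ F = (q+k+l) u₁₀ F`, `M₁₀ F = (q+k+l) u₀₁ F`, `(k+1) M₁₁ F = (q+k+l) H_k D^l + k(q+l−1) F_{k−1,l+1}`,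
`P₁₁ F = (p−l) F_{k+1,l−1}`, `P₀₁ F = −(p−l) u₁₀ F_{k,l−1}`, `P₁₀ F = −(p−l) u₀₁ F_{k,l−1}`, `(k+1) P₀₀ F = (p−l) H_k D^{l−1} + k(p−k−l−1) F_{k−1,l}`.
With `p = s+1+κ∕2`, `q = s+1−κ∕2` (S2-P) these are Lee's four affine transition scalars `c(λ→λ+e₁) = q+λ₁`, `c(λ→λ+e₂) = (k∕(k+1))(q+λ₂−1)`, `c(λ→λ−e₂) = p−λ₂`,
`c(λ→λ−e₁) = (k∕(k+1))(p−λ₁−1)` (TESTVECTORS §1 «HENCE»); the factors `k`, `k+1` are kept IN FRONT, so `k = 0` needs no side condition.  The K-type bookkeeping of the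
right-hand sides (`H_k D^l ∈ W_{λ+e₁}` etc.) is S2-K's (K-1), the analytic identification of `P, M` with the Lie derivatives is S2-P's, the paths are S2-C's.
* §1 ENGINE: `apply_det` (`d_{ij} det = adj_{ji}`), `apply_Dinv`, `Dz_sub_one_mul_det`, `Dinv_mul_Dz`, `apply_Dz` (`d_{ij} D^l = l D^{l−1} d_{ij} det`, by `ℤ`-induction from `hDz0`),
  `apply_fkl` — exported for S2-K (K-1)∕S2-P.
* §2 THE EIGHT IDENTITIES `mOp_zero_zero_fkl`, `mOp_zero_one_fkl`, `mOp_one_zero_fkl`, `succ_smul_mOp_one_one_fkl`, `pOp_one_one_fkl`, `pOp_zero_one_fkl`, `pOp_one_zero_fkl`,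
  `succ_smul_pOp_zero_zero_fkl`.
HONEST LABEL: HC_CM is proved only modulo the 7 printed citations (2 remaining named inputs: hLiu418 = stmt-HodgeConjecture-24832, h413 = stmt-HodgeConjecture-24833) until
rung 0 closes; this file is a count-neutral helper (pure algebra) and closes no item.

## Mathlib ∕ tree search
Tree ★: `K2LiuU22CompactPictureDefs.{mOp_apply, pOp_apply, fkl_apply, hk_apply}`; scalar-line instance ★ `K2LiuArchScalarSectionPDerivative.lieDeriv_pMinus∕pPlus` (sanity anchor, not imported).
Mathlib: `Derivation.leibniz`, `Derivation.leibniz_pow`, `Derivation.leibniz_of_mul_eq_one`, `Matrix.det_fin_two`, `Matrix.adjugate_fin_two`, `Int.induction_on`, `Algebra.smul_def`.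
Dedup: `rg "KTypeTransitions|mOp_zero_zero_fkl|apply_Dz"` over `Theorems/` — none.

## References
* [LeeZhu1998] S. T. Lee, C.-B. Zhu, *Degenerate principal series and local theta correspondence*, Trans. AMS 350 (1998) 5017–5046, p. 5032 (K-types `V_λ`, transition coefficients).
* [KashiwaraVergne1978] M. Kashiwara, M. Vergne, Invent. Math. 44 (1978), §II.5 (harmonic polynomials on matrix space).
-/

set_option autoImplicit false
-- the mandated namespace repeats `HodgeConjecture.HodgeConjecture`
set_option linter.dupNamespace false

noncomputable section

open Matrix

namespace Summit.HodgeConjecture.HodgeConjecture.Cruxes.HLiu418.K2LiuU22KTypeTransitions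

open Summit.HodgeConjecture.HodgeConjecture.Cruxes.HLiu418.K2LiuU22CompactPictureDefs

variable {R : Type*} [CommRing R] [Algebra ℂ R] (d : Fin 2 → Fin 2 → Derivation ℂ R R) (u : Matrix (Fin 2) (Fin 2) R) (Dinv : R)

/-! ## §1 The engine: derivatives of `det u`, `Dinv`, `D^l`, `u₀₀^k D^l` -/

section Engine

omit [Algebra ℂ R] in
/-- the entries of `adj(u)` for a `2 × 2` matrix. [folklore] -/
theorem adjugate_apply_fin_two :
    u.adjugate 0 0 = u 1 1 ∧ u.adjugate 0 1 = -u 0 1 ∧ u.adjugate 1 0 = -u 1 0 ∧ u.adjugate 1 1 = u 0 0 := by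
  rw [Matrix.adjugate_fin_two]
  exact ⟨rfl, rfl, rfl, rfl⟩

/-- **`d_{ij} det u = adj(u)_{ji}`** (`det = u₀₀u₁₁ − u₀₁u₁₀`, Leibniz, `d_{ij} u_{kl} = δ`). [cite: KashiwaraVergne1978, §II.5] -/
theorem apply_det (hd : ∀ i j k l : Fin 2, d i j (u k l) = if i = k ∧ j = l then 1 else 0) (i j : Fin 2) :
    d i j u.det = u.adjugate j i := by
  rw [Matrix.det_fin_two, Matrix.adjugate_fin_two, map_sub, Derivation.leibniz, Derivation.leibniz, hd, hd, hd, hd]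
  fin_cases i <;> fin_cases j <;> simp

/-- **`d_{ij} Dinv = −Dinv² · d_{ij} det u`** (Leibniz on `det u · Dinv = 1`). [cite: KashiwaraVergne1978, §II.5] -/
theorem apply_Dinv (hD : u.det * Dinv = 1) (i j : Fin 2) : d i j Dinv = -(Dinv * Dinv) * d i j u.det := by
  rw [(d i j).leibniz_of_mul_eq_one (show Dinv * u.det = 1 by rw [mul_comm]; exact hD), smul_eq_mul, pow_two]

variable (Dz : ℤ → R)

omit [Algebra ℂ R] in
/-- `D^{l−1} · det u = D^l`. [folklore] -/
theorem Dz_sub_one_mul_det (hDz : ∀ l : ℤ, Dz (l + 1) = Dz l * u.det) (l : ℤ) : Dz (l - 1) * u.det = Dz l := by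
  have h := hDz (l - 1)
  rw [sub_add_cancel] at h
  exact h.symm

omit [Algebra ℂ R] in
/-- `Dinv · D^l = D^{l−1}`. [folklore] -/
theorem Dinv_mul_Dz (hD : u.det * Dinv = 1) (hDz : ∀ l : ℤ, Dz (l + 1) = Dz l * u.det) (l : ℤ) : Dinv * Dz l = Dz (l - 1) := by
  calc Dinv * Dz l = Dinv * (Dz (l - 1) * u.det) := by rw [Dz_sub_one_mul_det u Dz hDz l]
    _ = Dz (l - 1) * (u.det * Dinv) := by ring
    _ = Dz (l - 1) := by rw [hD, mul_one]

/-- **`d_{ij} D^l = l · D^{l−1} · d_{ij} det u`** for every `l ∈ ℤ` (`ℤ`-induction: up by Leibniz on `D^{l+1} = D^l · det`, down on `D^{l−1} = Dinv · D^l` with `apply_Dinv`;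
the anchor `D⁰ = 1` is the hypothesis `hDz0`). [cite: KashiwaraVergne1978, §II.5] -/
theorem apply_Dz (hD : u.det * Dinv = 1) (hDz0 : Dz 0 = 1) (hDz : ∀ l : ℤ, Dz (l + 1) = Dz l * u.det) (i j : Fin 2) (l : ℤ) :
    d i j (Dz l) = (l : R) * (Dz (l - 1) * d i j u.det) := by
  induction l using Int.induction_on with
  | zero =>
    rw [hDz0, Int.cast_zero, zero_mul]
    exact (d i j).map_one_eq_zero
  | succ m ih =>
    rw [hDz, Derivation.leibniz, ih, smul_eq_mul, smul_eq_mul, add_sub_cancel_right, Int.cast_add, Int.cast_one]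
    have h := Dz_sub_one_mul_det u Dz hDz (m : ℤ)
    linear_combination ((m : ℤ) : R) * d i j u.det * h
  | pred m ih =>
    have h1 : Dz (-(m : ℤ) - 1) = Dinv * Dz (-(m : ℤ)) := (Dinv_mul_Dz u Dinv Dz hD hDz _).symm
    have h2 : Dz (-(m : ℤ) - 1 - 1) = Dinv * (Dinv * Dz (-(m : ℤ))) := by
      rw [← h1]; exact (Dinv_mul_Dz u Dinv Dz hD hDz _).symm
    rw [h1] at ih
    rw [h2, h1, Derivation.leibniz, ih, apply_Dinv d u Dinv hD, smul_eq_mul, smul_eq_mul, Int.cast_sub, Int.cast_one]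
    ring

/-- **THE ENGINE: `d_{ij}(u₀₀^k · D^l) = k·u₀₀^{k−1}·D^l·d_{ij}u₀₀ + l·u₀₀^k·D^{l−1}·d_{ij} det u`.** [cite: LeeZhu1998, p. 5032] -/
theorem apply_fkl (hD : u.det * Dinv = 1) (hDz0 : Dz 0 = 1) (hDz : ∀ l : ℤ, Dz (l + 1) = Dz l * u.det) (i j : Fin 2) (k : ℕ) (l : ℤ) :
    d i j (u 0 0 ^ k * Dz l) = (k : R) * u 0 0 ^ (k - 1) * Dz l * d i j (u 0 0) + (l : R) * u 0 0 ^ k * Dz (l - 1) * d i j u.det := by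
  rw [Derivation.leibniz, Derivation.leibniz_pow, apply_Dz d u Dinv Dz hD hDz0 hDz, smul_eq_mul, smul_eq_mul, smul_eq_mul, nsmul_eq_mul]
  ring

end Engine

/-! ## §2 The eight transition identities -/

section Identities

variable (Dz : ℤ → R) (hD : u.det * Dinv = 1) (hd : ∀ i j k l : Fin 2, d i j (u k l) = if i = k ∧ j = l then 1 else 0)
  (hDz0 : Dz 0 = 1) (hDz : ∀ l : ℤ, Dz (l + 1) = Dz l * u.det)
include hD hd hDz0 hDz

/-- **(1) `M₀₀ F_{k,l} = (q + k + l) · F_{k+1,l}`** — the arrow `λ → λ + e₁` (`λ = (k+l, l)`), scalar `q + λ₁`. [cite: LeeZhu1998, p. 5032] -/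
theorem mOp_zero_zero_fkl (q : ℂ) (k : ℕ) (l : ℤ) :
    mOp d u q 0 0 (fkl u Dz k l) = (q + k + l : ℂ) • fkl u Dz (k + 1) l := by
  have hl : Dz l = Dz (l - 1) * u.det := (Dz_sub_one_mul_det u Dz hDz l).symm
  simp only [mOp_apply, fkl_apply, Fin.sum_univ_two, apply_fkl d u Dinv Dz hD hDz0 hDz, hd, apply_det d u hd, (adjugate_apply_fin_two u).1,
    (adjugate_apply_fin_two u).2.1, (adjugate_apply_fin_two u).2.2.1, (adjugate_apply_fin_two u).2.2.2, Fin.isValue, and_true, and_false,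
    if_true, if_false, one_ne_zero, Algebra.smul_def, map_add, map_natCast, map_intCast]
  rw [hl, Matrix.det_fin_two]
  cases k with
  | zero => simp; ring
  | succ m => rw [Nat.add_sub_cancel]; push_cast; ring

/-- **(2) `M₀₁ F_{k,l} = (q + k + l) · u₁₀ F_{k,l}`** (arrow `λ → λ + e₁`). [cite: LeeZhu1998, p. 5032] -/
theorem mOp_zero_one_fkl (q : ℂ) (k : ℕ) (l : ℤ) :
    mOp d u q 0 1 (fkl u Dz k l) = (q + k + l : ℂ) • (u 1 0 * fkl u Dz k l) := by
  have hl : Dz l = Dz (l - 1) * u.det := (Dz_sub_one_mul_det u Dz hDz l).symm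
  simp only [mOp_apply, fkl_apply, Fin.sum_univ_two, apply_fkl d u Dinv Dz hD hDz0 hDz, hd, apply_det d u hd, (adjugate_apply_fin_two u).1,
    (adjugate_apply_fin_two u).2.1, (adjugate_apply_fin_two u).2.2.1, (adjugate_apply_fin_two u).2.2.2, Fin.isValue, and_true, and_false,
    if_true, if_false, one_ne_zero, Algebra.smul_def, map_add, map_natCast, map_intCast]
  rw [hl, Matrix.det_fin_two]
  cases k with
  | zero => simp; ring
  | succ m => rw [Nat.add_sub_cancel]; push_cast; ring

/-- **(3) `M₁₀ F_{k,l} = (q + k + l) · u₀₁ F_{k,l}`** (arrow `λ → λ + e₁`). [cite: LeeZhu1998, p. 5032] -/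
theorem mOp_one_zero_fkl (q : ℂ) (k : ℕ) (l : ℤ) :
    mOp d u q 1 0 (fkl u Dz k l) = (q + k + l : ℂ) • (u 0 1 * fkl u Dz k l) := by
  have hl : Dz l = Dz (l - 1) * u.det := (Dz_sub_one_mul_det u Dz hDz l).symm
  simp only [mOp_apply, fkl_apply, Fin.sum_univ_two, apply_fkl d u Dinv Dz hD hDz0 hDz, hd, apply_det d u hd, (adjugate_apply_fin_two u).1,
    (adjugate_apply_fin_two u).2.1, (adjugate_apply_fin_two u).2.2.1, (adjugate_apply_fin_two u).2.2.2, Fin.isValue, and_true, and_false,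
    if_true, if_false, one_ne_zero, Algebra.smul_def, map_add, map_natCast, map_intCast]
  rw [hl, Matrix.det_fin_two]
  cases k with
  | zero => simp; ring
  | succ m => rw [Nat.add_sub_cancel]; push_cast; ring

/-- **(4) `(k+1) · M₁₁ F_{k,l} = (q + k + l) · H_k D^l + k (q + l − 1) · F_{k−1,l+1}`** — the arrows `λ → λ + e₁` (scalar `q + λ₁`) and `λ → λ + e₂` (scalar `(k∕(k+1))(q + λ₂ − 1)`);
the factors `k+1`, `k` are kept in front (no side condition at `k = 0`). [cite: LeeZhu1998, p. 5032] -/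
theorem succ_smul_mOp_one_one_fkl (q : ℂ) (k : ℕ) (l : ℤ) :
    ((k : ℂ) + 1) • mOp d u q 1 1 (fkl u Dz k l) = (q + k + l : ℂ) • (hk u k * Dz l) + ((k : ℂ) * (q + l - 1)) • fkl u Dz (k - 1) (l + 1) := by
  have hl : Dz l = Dz (l - 1) * u.det := (Dz_sub_one_mul_det u Dz hDz l).symm
  have hl1 : Dz (l + 1) = Dz (l - 1) * u.det * u.det := by rw [hDz, hl]
  simp only [mOp_apply, fkl_apply, hk_apply, Fin.sum_univ_two, apply_fkl d u Dinv Dz hD hDz0 hDz, hd, apply_det d u hd, (adjugate_apply_fin_two u).1,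
    (adjugate_apply_fin_two u).2.1, (adjugate_apply_fin_two u).2.2.1, (adjugate_apply_fin_two u).2.2.2, Fin.isValue, and_true, and_false,
    if_true, if_false, one_ne_zero, Algebra.smul_def, map_add, map_sub, map_mul, map_one, map_natCast, map_intCast]
  rw [hl1, hl, Matrix.det_fin_two]
  cases k with
  | zero => simp; ring
  | succ m => rw [Nat.add_sub_cancel]; push_cast; ring

/-- **(5) `P₁₁ F_{k,l} = (p − l) · F_{k+1,l−1}`** — the arrow `λ → λ − e₂`, scalar `p − λ₂`. [cite: LeeZhu1998, p. 5032] -/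
theorem pOp_one_one_fkl (p : ℂ) (k : ℕ) (l : ℤ) :
    pOp d u Dinv p 1 1 (fkl u Dz k l) = (p - l : ℂ) • fkl u Dz (k + 1) (l - 1) := by
  have hl : Dz l = Dz (l - 1) * u.det := (Dz_sub_one_mul_det u Dz hDz l).symm
  have hDl : ∀ x : R, Dinv * x * (u 0 0 ^ k * Dz l) = x * u 0 0 ^ k * Dz (l - 1) := fun x => by
    rw [← Dinv_mul_Dz u Dinv Dz hD hDz l]; ring
  simp only [pOp_apply, fkl_apply, hDl, apply_fkl d u Dinv Dz hD hDz0 hDz, hd, apply_det d u hd,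
    (adjugate_apply_fin_two u).2.2.2, Fin.isValue, and_self,
    if_false, one_ne_zero, Algebra.smul_def, map_sub, map_intCast]
  rw [hl, Matrix.det_fin_two]
  cases k with
  | zero => simp; ring
  | succ m => rw [Nat.add_sub_cancel]; push_cast; ring

/-- **(6) `P₀₁ F_{k,l} = −(p − l) · u₁₀ F_{k,l−1}`** (arrow `λ → λ − e₂`). [cite: LeeZhu1998, p. 5032] -/
theorem pOp_zero_one_fkl (p : ℂ) (k : ℕ) (l : ℤ) :
    pOp d u Dinv p 0 1 (fkl u Dz k l) = -((p - l : ℂ) • (u 1 0 * fkl u Dz k (l - 1))) := by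
  have hl : Dz l = Dz (l - 1) * u.det := (Dz_sub_one_mul_det u Dz hDz l).symm
  have hDl : ∀ x : R, Dinv * x * (u 0 0 ^ k * Dz l) = x * u 0 0 ^ k * Dz (l - 1) := fun x => by
    rw [← Dinv_mul_Dz u Dinv Dz hD hDz l]; ring
  simp only [pOp_apply, fkl_apply, hDl, apply_fkl d u Dinv Dz hD hDz0 hDz, hd, apply_det d u hd,
    (adjugate_apply_fin_two u).2.2.1, Fin.isValue, and_false,
    if_false, one_ne_zero, Algebra.smul_def, map_sub, map_intCast]
  rw [hl, Matrix.det_fin_two]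
  cases k with
  | zero => simp; ring
  | succ m => rw [Nat.add_sub_cancel]; push_cast; ring

/-- **(7) `P₁₀ F_{k,l} = −(p − l) · u₀₁ F_{k,l−1}`** (arrow `λ → λ − e₂`). [cite: LeeZhu1998, p. 5032] -/
theorem pOp_one_zero_fkl (p : ℂ) (k : ℕ) (l : ℤ) :
    pOp d u Dinv p 1 0 (fkl u Dz k l) = -((p - l : ℂ) • (u 0 1 * fkl u Dz k (l - 1))) := by
  have hl : Dz l = Dz (l - 1) * u.det := (Dz_sub_one_mul_det u Dz hDz l).symm
  have hDl : ∀ x : R, Dinv * x * (u 0 0 ^ k * Dz l) = x * u 0 0 ^ k * Dz (l - 1) := fun x => by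
    rw [← Dinv_mul_Dz u Dinv Dz hD hDz l]; ring
  simp only [pOp_apply, fkl_apply, hDl, apply_fkl d u Dinv Dz hD hDz0 hDz, hd, apply_det d u hd,
    (adjugate_apply_fin_two u).2.1, Fin.isValue, and_true,
    if_false, one_ne_zero, Algebra.smul_def, map_sub, map_intCast]
  rw [hl, Matrix.det_fin_two]
  cases k with
  | zero => simp; ring
  | succ m => rw [Nat.add_sub_cancel]; push_cast; ring

/-- **(8) `(k+1) · P₀₀ F_{k,l} = (p − l) · H_k D^{l−1} + k (p − k − l − 1) · F_{k−1,l}`** — the arrows `λ → λ − e₂` (scalar `p − λ₂`) and `λ → λ − e₁` (scalar `(k∕(k+1))(p − λ₁ − 1)`);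
factors `k+1`, `k` in front. [cite: LeeZhu1998, p. 5032] -/
theorem succ_smul_pOp_zero_zero_fkl (p : ℂ) (k : ℕ) (l : ℤ) :
    ((k : ℂ) + 1) • pOp d u Dinv p 0 0 (fkl u Dz k l) = (p - l : ℂ) • (hk u k * Dz (l - 1)) + ((k : ℂ) * (p - k - l - 1)) • fkl u Dz (k - 1) l := by
  have hl : Dz l = Dz (l - 1) * u.det := (Dz_sub_one_mul_det u Dz hDz l).symm
  have hDl : ∀ x : R, Dinv * x * (u 0 0 ^ k * Dz l) = x * u 0 0 ^ k * Dz (l - 1) := fun x => by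
    rw [← Dinv_mul_Dz u Dinv Dz hD hDz l]; ring
  simp only [pOp_apply, fkl_apply, hk_apply, hDl, apply_fkl d u Dinv Dz hD hDz0 hDz, hd, apply_det d u hd, (adjugate_apply_fin_two u).1,
    Fin.isValue, and_self,
    if_true, Algebra.smul_def, map_add, map_sub, map_mul, map_one, map_natCast, map_intCast]
  rw [hl, Matrix.det_fin_two]
  cases k with
  | zero => simp; ring
  | succ m => rw [Nat.add_sub_cancel]; push_cast; ring

end Identities

end Summit.HodgeConjecture.HodgeConjecture.Cruxes.HLiu418.K2LiuU22KTypeTransitions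

end
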